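import Mathlib
import Literature.MathematicalPhysics.QuantumFieldTheory.PottsGaugeWilsonLoopAreaLaw
import HarnessLib

/-!
# The area of a rectangular Wilson loop on the torus, the two-sided area law for `q`-state Potts
# lattice gauge theory at strong coupling, translation invariance and supermultiplicativity of
# rectangular Wilson loops — PROVED on `𝕋^d_L`

Eleventh file of the transcription of the Fortuin–Kasteleyn-type ("plaquette random-cluster")
representation of `q`-state Potts lattice gauge theory (companions: `PlaquetteRandomCluster` —
setting, readings (R1)–(R3), (R7) and the SCOPE caveat —, `PottsGaugeWilsonLoopMonotonicity`
(the area-law LOWER bound `𝔼_β W_{∂c} ≥ p̂^{|supp c|}`), `PottsGaugeWilsonLoopAreaLaw` (the Peierls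
UPPER bound `𝔼_β W_γ ≤ (κβ)^{area(γ)}/(1 - κβ)`, `area(γ)` = least number of plaquettes of a
spanning `2`-chain)).

## Scope (read this first)

Nothing in this file bears on the Clay Yang–Mills mass-gap problem: finite abelian gauge group `ℤ_q`,
finite torus, strong coupling. In the `ym` ladder only the conditional finite-`𝕋⁴` rung
`BalabanLadder.UV` is closed by any current route; `BalabanLadder.IR` is untouched. The file closes
the gap between the two companion bounds and the AREA of a loop: both are stated in terms of a
spanning chain (`|supp c|`, resp. `area(γ) = min |supp τ|`), and the printed sources pass to the
quark potential / string tension of an `R × T` rectangle by the evaluation `area(∂(R × T)) = RT`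
([ForsstromViklund2025currents, Cor. 6.4, Prop. 6.5: "`V_β(R) ≥ a_β R`" from the estimate in
`area(γ_{R,T})`]; [DuncanSchweinhart2025, §1: "if `γ = ∂ρ` is a `1`-boundary and `ρ` is the minimal
bounding chain then the expectation of `W_{∂ρ}` should decay as `e^{-c|ρ|}`", Thm. 7:
"hyperrectangular `(i-1)`-boundaries `γ`", `exp(-c₃ Area(γ)) ≤ μ(V_γ)`]), which is used there
without comment. On the TORUS this evaluation is a small theorem with a twist, typed here.

## Sources

* M. P. Forsström, F. Viklund, arXiv:2502.19942 [ForsstromViklund2025currents], §6: Cor. 6.4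
  (axis-parallel rectangle `γ_{R,T}` with side-lengths `R, T`), Prop. 6.5 (area law, `area(γ)`)
  [corpus:paper:arxiv-2502.19942 p0010 L85–p0011 L40].
* P. Duncan, B. Schweinhart, CMP **406** (2025), arXiv:2207.08339 [DuncanSchweinhart2025], §1
  [corpus:paper:arxiv-2207.08339 p0005 L12] and Thm. 7 [p0006 L29–45] (as quoted above).

## What is typed (transcriber's form, flagged)

For directions `i < j`, a corner `x₀ ∈ 𝕋^d_L` and side lengths `Rr, T ≤ L`, the rectangle `2`-chain
`ρ = rectChain x₀ hij Rr T = Σ_{0 ≤ a < Rr, 0 ≤ b < T} 𝟙_{(x₀ + a e_i + b e_j; i, j)}` (`Rr·T`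
plaquettes, `card_chainSupport_rectChain`) and its boundary, the rectangular loop `∂ρ`. The main
result is the ISOPERIMETRIC COUNT `min_le_card_chainSupport_of_bd₂_eq_rect`: every `R`-valued
`2`-chain `τ` (any non-trivial commutative ring `R`) with `∂τ = ∂ρ` has at least
`min(Rr·T, L² - Rr·T)` plaquettes. (On the torus the loop `∂ρ` ALSO bounds "`ρ` minus the whole
`{i,j}`-torus through `x₀`", with `L² - Rr·T` plaquettes — whence the `min`; for `2·Rr·T ≤ L²` the
minimum is `Rr·T`: `area_bd₂_rectChain_eq`.) Proof (ours; the sources do not spell one out):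
project chains to the `2`-torus `𝕋²_L` of the plane `{i,j}` by fibre sums (`projChain`, `projOne`);
this is a chain map (`projOne_bd₂_fst`, `projOne_bd₂_snd`: contributions of plaquettes in planes
`{i,m}`, `{j,m}`, `m ∉ {i,j}`, cancel in pairs along the fibres), so `τ̄ - ρ̄` is a `2`-cycle of
`𝕋²_L`, i.e. a constant `c` (`projChain_sub_projChain_const`); `ρ̄ = 𝟙_{rectangle}`
(`projChain_rectChain`), and `𝟙_{rectangle} + c` is non-zero on the rectangle (`c ≠ -1`) or on its
complement (`c = -1`); finally `|supp τ| ≥ |supp τ̄|` (`card_filter_projChain_ne_zero_le`).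
Consequences (`2·Rr·T ≤ L²`, prime `q`, `β > 0`): the TWO-SIDED AREA LAW for rectangular Wilson
loops of `q`-state Potts lattice gauge theory on `𝕋^d_L`, uniformly in `L`,
`((e^β-1)/(e^β-1+q))^{Rr·T} ≤ 𝔼_{ν_β} W_{∂ρ} ≤ (κβ)^{Rr·T}/(1 - κβ)` for `κβ < 1`, `κ = 2(d-1)(q-1)`
(`pow_le_pottsExpect_wilsonLoop_rect`, `pottsExpect_wilsonLoop_rect_le`), and the plaquette
random-cluster form `μ_{p,q}(V_{∂ρ}) ≤ (κp)^{Rr·T}/(1 - κp)` (`eventProb_nullHomologous_rect_le`).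

Also typed (second part of the file), the finite-volume content of
[ForsstromViklund2025currents, Cor. 6.4] ("`T ↦ -log⟨W_{γ_{R,T}}⟩_β` is subadditive", by
Prop. 6.3(i) and translation invariance; the Fekete limit `T → ∞` defining the quark potential
`V_β(R)` needs the infinite volume and is NOT typed): translation invariance of Potts lattice gauge
theory on the torus (`flatCount_shiftCochain₁`, `pottsExpect_comp_shiftCochain₁`), of Wilson loops
(`wilsonLoopVar_shiftCochain₁_neg`, `pottsExpect_wilsonLoopVar_shift`, `bd₂_shiftChain₂`,
`rectChain_add_corner`, `pottsExpect_wilsonLoop_rect_corner`), the concatenation of rectangles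
`ρ(Rr, T+T') = ρ(Rr, T) + ρ_{x₀ + T e_j}(Rr, T')` for `T + T' ≤ L` (`rectSites_add`,
`disjoint_rectSites`, `rectChain_add`), Griffiths II in the form
`𝔼_β W_{∂(c+c')} ≥ 𝔼_β W_{∂c} 𝔼_β W_{∂c'}` (`pottsExpect_wilsonLoopVar_bd₂_add_ge`) and the
SUPERMULTIPLICATIVITY `𝔼_β W_{∂ρ(Rr,T+T')} ≥ 𝔼_β W_{∂ρ(Rr,T)} · 𝔼_β W_{∂ρ(Rr,T')}`
(`pottsExpect_wilsonLoop_rect_supermul`, prime `q`, `β > 0`); and the `q = 2` dictionary with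
[ForsstromViklund2025currents, eq. (1.7), Prop. 6.6, Thm. 1.3]: `p̂(1 - e^{-β}, 2) = tanh(β/2)`
(`hatParam_esParam_two`; with `β = 4β_FV` the sandwich parameters are the printed `tanh 2β_FV` and
`1 - e^{-4β_FV}`) and `ψ_{tanh(β/2)}(V_γ) ≤ 𝔼_β W_γ ≤ ψ_{1-e^{-β}}(V_γ)` for Ising lattice gauge theory
on the torus (`wilsonLoop_percolation_sandwich_two`).

Everything in this file is PROVED; no named fact is introduced.
-/

open Finset

namespace Literature.MathematicalPhysics.QuantumFieldTheory

namespace PlaquetteRC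

open LatticeForm

variable {d L : ℕ}

/-! ### Sites: shifting by a unit vector -/

section Sites

/-- `(y + e_m)(k) = y(k)` for `k ≠ m`. [folklore] -/
private theorem add_te_apply_ne (y : Site d L) {m k : Fin d} (h : k ≠ m) :
    (y + te m : Site d L) k = y k := by
  dsimp only [te]
  rw [Pi.add_apply, Pi.single_apply, if_neg h, add_zero]

/-- `(y + e_m)(m) = y(m) + 1`. [folklore] -/
private theorem add_te_apply_self (y : Site d L) (m : Fin d) : (y + te m : Site d L) m = y m + 1 := by
  dsimp only [te]
  rw [Pi.add_apply, Pi.single_eq_same]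

end Sites

variable [NeZero L]

/-! ### Fibres of the coordinate projection `y ↦ (y_i, y_j)` and the projected chains -/

section Projection

variable (i j : Fin d)

/-- The fibre `{y : y_i = u, y_j = v}` of the coordinate projection of `𝕋^d_L` onto the `2`-torus
`𝕋²_L` of the plane `{i, j}`. [cite: ForsstromViklund2025currents, §6 before Prop. 6.5 (area(γ))] -/
def fibre (u v : ZMod L) : Finset (Site d L) := Finset.univ.filter fun y => y i = u ∧ y j = v

variable {i j}

/-- Membership in a fibre. [cite: ForsstromViklund2025currents, §6 before Prop. 6.5 (area(γ))] -/
@[simp] theorem mem_fibre {u v : ZMod L} {y : Site d L} : y ∈ fibre i j u v ↔ y i = u ∧ y j = v := by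
  simp [fibre]

/-- Shifting in a direction outside the plane stays in the fibre. [folklore] -/
private theorem add_te_mem_fibre_iff_of_ne {u v : ZMod L} {y : Site d L} {m : Fin d}
    (hmi : m ≠ i) (hmj : m ≠ j) : y + te m ∈ fibre i j u v ↔ y ∈ fibre i j u v := by
  rw [mem_fibre, mem_fibre, add_te_apply_ne y hmi.symm, add_te_apply_ne y hmj.symm]

/-- Shifting by `e_j` moves the fibre index `v` by one. [folklore] -/
private theorem add_te_mem_fibre_iff_snd {u v : ZMod L} {y : Site d L} (hij : i ≠ j) :
    y + te j ∈ fibre i j u v ↔ y ∈ fibre i j u (v - 1) := by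
  rw [mem_fibre, mem_fibre, add_te_apply_ne y hij, add_te_apply_self, eq_sub_iff_add_eq]

/-- Shifting by `e_i` moves the fibre index `u` by one. [folklore] -/
private theorem add_te_mem_fibre_iff_fst {u v : ZMod L} {y : Site d L} (hij : i ≠ j) :
    y + te i ∈ fibre i j u v ↔ y ∈ fibre i j (u - 1) v := by
  rw [mem_fibre, mem_fibre, add_te_apply_ne y hij.symm, add_te_apply_self, eq_sub_iff_add_eq]

variable {R : Type*} [CommRing R]

variable (i j) in
/-- **Projection of a plaquette `2`-chain to the `2`-torus of the plane `{i,j}`**: the fibre sums of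
its `{i,j}`-plaquettes, `τ̄(u,v) = Σ_{y : (y_i,y_j) = (u,v)} τ(y; i, j)`.
[cite: ForsstromViklund2025currents, §6 before Prop. 6.5 (area(γ))] -/
def projChain (hij : i < j) (τ : Plaquette d L → R) (uv : ZMod L × ZMod L) : R :=
  ∑ y ∈ fibre i j uv.1 uv.2, τ (y, ⟨(i, j), hij⟩)

variable (i j) in
/-- **Projection of a `1`-chain**: the fibre sums of its `i`-edges (`b = false`) and of its `j`-edges
(`b = true`); edges in the other directions are dropped. [cite: ForsstromViklund2025currents, §6 before Prop. 6.5 (area(γ))] -/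
def projOne (γ : Site d L → Fin d → R) (uv : ZMod L × ZMod L) (b : Bool) : R :=
  ∑ y ∈ fibre i j uv.1 uv.2, γ y (if b then j else i)

/-- Fibre sum of the coefficient of the `i`-edge at `x` in `∂P`, over `x` in a fibre: only the
`{i,j}`-plaquettes contribute, with `[P ∈ fibre(u,v)] - [P ∈ fibre(u,v-1)]`; the contributions of the
plaquettes in planes `{i,m}`, `m ∉ {i,j}`, cancel in pairs. [folklore] -/
private theorem sum_fibre_res_td₁_edgeInd_fst (hij : i < j) (u v : ZMod L) (y : Site d L)
    (a b : Fin d) (hab : a < b) :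
    ∑ x ∈ fibre i j u v, res (td₁ (edgeInd (R := R) x i)) (y, ⟨(a, b), hab⟩) =
      if a = i ∧ b = j then
        (if y ∈ fibre i j u v then 1 else 0) - (if y ∈ fibre i j u (v - 1) then 1 else 0)
      else 0 := by
  have hne : i ≠ j := ne_of_lt hij
  simp only [res, td₁, edgeInd]
  by_cases ha : a = i
  · subst ha
    have hb : b ≠ a := (ne_of_lt hab).symm
    simp only [hb, and_false, if_false, add_zero, sub_zero, and_true, true_and,
      Finset.sum_sub_distrib, Finset.sum_ite_eq]
    by_cases hbj : b = j
    · subst hbj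
      simp only [if_true, add_te_mem_fibre_iff_snd hne]
    · simp only [if_neg hbj, add_te_mem_fibre_iff_of_ne hb hbj, sub_self]
  · have hcond : ¬(a = i ∧ b = j) := fun h => ha h.1
    rw [if_neg hcond]
    by_cases hb : b = i
    · subst hb
      have haj : a ≠ j := fun h => (lt_asymm hab) (h ▸ hij)
      simp only [ha, and_false, if_false, zero_add, sub_zero, and_true, Finset.sum_sub_distrib,
        Finset.sum_ite_eq, add_te_mem_fibre_iff_of_ne ha haj, sub_self]
    · simp [ha, hb]

/-- The same for the `j`-edges: `[P ∈ fibre(u-1,v)] - [P ∈ fibre(u,v)]` on `{i,j}`-plaquettes, `0`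
otherwise. [folklore] -/
private theorem sum_fibre_res_td₁_edgeInd_snd (hij : i < j) (u v : ZMod L) (y : Site d L)
    (a b : Fin d) (hab : a < b) :
    ∑ x ∈ fibre i j u v, res (td₁ (edgeInd (R := R) x j)) (y, ⟨(a, b), hab⟩) =
      if a = i ∧ b = j then
        (if y ∈ fibre i j (u - 1) v then 1 else 0) - (if y ∈ fibre i j u v then 1 else 0)
      else 0 := by
  have hne : i ≠ j := ne_of_lt hij
  simp only [res, td₁, edgeInd]
  by_cases hb : b = j
  · subst hb
    have ha : a ≠ b := ne_of_lt hab
    simp only [ha, and_false, if_false, zero_add, and_true, Finset.sum_sub_distrib,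
      Finset.sum_ite_eq, sub_zero]
    by_cases hai : a = i
    · subst hai
      simp only [if_true, add_te_mem_fibre_iff_fst hne]
    · simp only [if_neg hai, add_te_mem_fibre_iff_of_ne hai ha, sub_self]
  · have hcond : ¬(a = i ∧ b = j) := fun h => hb h.2
    rw [if_neg hcond]
    by_cases ha : a = j
    · subst ha
      have hbi : b ≠ i := fun h => (lt_asymm hab) (h ▸ hij)
      simp only [hb, and_false, if_false, add_zero, and_true, Finset.sum_sub_distrib,
        Finset.sum_ite_eq, sub_zero, add_te_mem_fibre_iff_of_ne hbi hb, sub_self]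
    · simp [ha, hb]

/-- Summing a function of plaquettes supported on the plane `{i,j}` reduces to a sum over base
points. [folklore] -/
private theorem sum_plaquette_ite_plane (hij : i < j) (g : Site d L → R) (τ : Plaquette d L → R) :
    ∑ P : Plaquette d L, τ P * (if P.2.1.1 = i ∧ P.2.1.2 = j then g P.1 else 0) =
      ∑ y : Site d L, τ (y, ⟨(i, j), hij⟩) * g y := by
  rw [Fintype.sum_prod_type]
  refine Finset.sum_congr rfl fun y _ => ?_
  rw [Finset.sum_eq_single ⟨(i, j), hij⟩]
  · simp
  · rintro ⟨⟨a, b⟩, hab⟩ - hne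
    have : ¬(a = i ∧ b = j) := by
      rintro ⟨rfl, rfl⟩
      exact hne rfl
    simp [this]
  · intro h; exact absurd (Finset.mem_univ _) h

/-- **The projection is a chain map, `i`-edges**: `π₁(∂τ)(u,v; i) = τ̄(u,v) - τ̄(u,v-1)`.
[cite: ForsstromViklund2025currents, §6 before Prop. 6.5 (area(γ))] -/
theorem projOne_bd₂_fst (hij : i < j) (τ : Plaquette d L → R) (u v : ZMod L) :
    projOne i j (bd₂ τ) (u, v) false = projChain i j hij τ (u, v) - projChain i j hij τ (u, v - 1) := by
  simp only [projOne, Bool.false_eq_true, if_false, bd₂]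
  rw [Finset.sum_comm]
  simp_rw [← Finset.mul_sum]
  have h : ∀ P : Plaquette d L, ∑ x ∈ fibre i j u v, res (td₁ (edgeInd (R := R) x i)) P =
      if P.2.1.1 = i ∧ P.2.1.2 = j then
        ((if P.1 ∈ fibre i j u v then 1 else 0) - (if P.1 ∈ fibre i j u (v - 1) then 1 else 0))
      else 0 := by
    rintro ⟨y, ⟨a, b⟩, hab⟩
    exact sum_fibre_res_td₁_edgeInd_fst hij u v y a b hab
  simp_rw [h]
  refine (sum_plaquette_ite_plane hij (fun y => (if y ∈ fibre i j u v then (1 : R) else 0) -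
    (if y ∈ fibre i j u (v - 1) then 1 else 0)) τ).trans ?_
  simp only [mul_sub, Finset.sum_sub_distrib, mul_ite, mul_one, mul_zero, projChain]
  rw [Finset.sum_ite_mem, Finset.sum_ite_mem, Finset.univ_inter, Finset.univ_inter]

/-- **The projection is a chain map, `j`-edges**: `π₁(∂τ)(u,v; j) = τ̄(u-1,v) - τ̄(u,v)`.
[cite: ForsstromViklund2025currents, §6 before Prop. 6.5 (area(γ))] -/
theorem projOne_bd₂_snd (hij : i < j) (τ : Plaquette d L → R) (u v : ZMod L) :
    projOne i j (bd₂ τ) (u, v) true = projChain i j hij τ (u - 1, v) - projChain i j hij τ (u, v) := by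
  simp only [projOne, if_true, bd₂]
  rw [Finset.sum_comm]
  simp_rw [← Finset.mul_sum]
  have h : ∀ P : Plaquette d L, ∑ x ∈ fibre i j u v, res (td₁ (edgeInd (R := R) x j)) P =
      if P.2.1.1 = i ∧ P.2.1.2 = j then
        ((if P.1 ∈ fibre i j (u - 1) v then 1 else 0) - (if P.1 ∈ fibre i j u v then 1 else 0))
      else 0 := by
    rintro ⟨y, ⟨a, b⟩, hab⟩
    exact sum_fibre_res_td₁_edgeInd_snd hij u v y a b hab
  simp_rw [h]
  refine (sum_plaquette_ite_plane hij (fun y => (if y ∈ fibre i j (u - 1) v then (1 : R) else 0) -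
    (if y ∈ fibre i j u v then 1 else 0)) τ).trans ?_
  simp only [mul_sub, Finset.sum_sub_distrib, mul_ite, mul_one, mul_zero, projChain]
  rw [Finset.sum_ite_mem, Finset.sum_ite_mem, Finset.univ_inter, Finset.univ_inter]

/-- A function on `𝕋²_L` invariant under both unit shifts is constant (`H₂(𝕋²) = R`: a `2`-cycle of
the `2`-torus is a constant multiple of the fundamental class). [folklore] -/
private theorem eq_of_shift_invariant {α : Type*} {f : ZMod L × ZMod L → α}
    (h1 : ∀ u v, f (u, v) = f (u, v - 1)) (h2 : ∀ u v, f (u - 1, v) = f (u, v)) (u v : ZMod L) :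
    f (u, v) = f (0, 0) := by
  have hv : ∀ (n : ℕ) (u w : ZMod L), f (u, w) = f (u, w - (n : ZMod L)) := by
    intro n
    induction n with
    | zero => intro u w; rw [Nat.cast_zero, sub_zero]
    | succ n ih =>
      intro u w
      rw [ih u w, h1 u (w - (n : ZMod L)), Nat.cast_succ, sub_sub]
  have hu : ∀ (n : ℕ) (u w : ZMod L), f (u, w) = f (u - (n : ZMod L), w) := by
    intro n
    induction n with
    | zero => intro u w; rw [Nat.cast_zero, sub_zero]
    | succ n ih =>
      intro u w
      rw [ih u w, ← h2 (u - (n : ZMod L)) w, Nat.cast_succ, sub_sub]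
  rw [hv v.val u v, ZMod.natCast_zmod_val, sub_self, hu u.val u 0, ZMod.natCast_zmod_val, sub_self]

/-- **Two chains with the same boundary have projections differing by a constant.**
[cite: ForsstromViklund2025currents, §6 before Prop. 6.5 (area(γ))] -/
theorem projChain_sub_projChain_const (hij : i < j) {τ ρ : Plaquette d L → R} (h : bd₂ τ = bd₂ ρ)
    (uv : ZMod L × ZMod L) :
    projChain i j hij τ uv - projChain i j hij ρ uv =
      projChain i j hij τ (0, 0) - projChain i j hij ρ (0, 0) := by
  obtain ⟨u, v⟩ := uv
  refine eq_of_shift_invariant (f := fun uv => projChain i j hij τ uv - projChain i j hij ρ uv)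
    (fun u v => ?_) (fun u v => ?_) u v
  · have hτ := projOne_bd₂_fst (R := R) hij τ u v
    have hρ := projOne_bd₂_fst (R := R) hij ρ u v
    rw [h] at hτ
    rw [hτ] at hρ
    -- hρ : τ̄(u,v) - τ̄(u,v-1) = ρ̄(u,v) - ρ̄(u,v-1)
    linear_combination hρ
  · have hτ := projOne_bd₂_snd (R := R) hij τ u v
    have hρ := projOne_bd₂_snd (R := R) hij ρ u v
    rw [h] at hτ
    rw [hτ] at hρ
    linear_combination hρ

/-- **The support of a chain is at least as large as the support of its projection.**
[cite: ForsstromViklund2025currents, §6 before Prop. 6.5 (area(γ))] -/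
theorem card_filter_projChain_ne_zero_le [DecidableEq R] (hij : i < j) (τ : Plaquette d L → R) :
    (Finset.univ.filter fun uv : ZMod L × ZMod L => projChain i j hij τ uv ≠ 0).card ≤
      (chainSupport τ).card := by
  classical
  -- every non-zero fibre sum has a non-zero term; project the support back
  let π : Plaquette d L → ZMod L × ZMod L := fun P => (P.1 i, P.1 j)
  calc (Finset.univ.filter fun uv : ZMod L × ZMod L => projChain i j hij τ uv ≠ 0).card
      ≤ ((chainSupport τ).image π).card := by
        refine Finset.card_le_card fun uv huv => ?_
        rw [Finset.mem_filter] at huv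
        obtain ⟨y, hy, hτy⟩ := Finset.exists_ne_zero_of_sum_ne_zero huv.2
        rw [Finset.mem_image]
        refine ⟨(y, ⟨(i, j), hij⟩), by simp [chainSupport, hτy], ?_⟩
        rw [mem_fibre] at hy
        obtain ⟨u, v⟩ := uv
        simp only [π, Prod.mk.injEq]
        exact hy
    _ ≤ (chainSupport τ).card := Finset.card_image_le

end Projection

/-! ### Rectangles -/

section Rectangle

variable {R : Type*} [CommRing R]

/-- The sites of the `Rr × T` rectangle with corner `x₀` in the plane `{i, j}`:
`y_i - x₀_i ∈ [0, Rr)`, `y_j - x₀_j ∈ [0, T)`, all other coordinates those of `x₀`.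
[cite: ForsstromViklund2025currents, Cor. 6.4 (axis-parallel rectangle with side-lengths R, T)] -/
def rectSites (x₀ : Site d L) (i j : Fin d) (Rr T : ℕ) : Finset (Site d L) :=
  Finset.univ.filter fun y =>
    (y i - x₀ i).val < Rr ∧ (y j - x₀ j).val < T ∧ ∀ k, k ≠ i → k ≠ j → y k = x₀ k

/-- **The rectangle `2`-chain** `ρ = Σ_{y ∈ rectangle} 𝟙_{(y; i, j)}` (the minimal surface spanned by
the rectangular loop `∂ρ`). [cite: ForsstromViklund2025currents, Cor. 6.4 and Prop. 6.5 (γ_{R,T})] -/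
def rectChain (x₀ : Site d L) {i j : Fin d} (hij : i < j) (Rr T : ℕ) : Plaquette d L → R :=
  fun P => if P.2 = ⟨(i, j), hij⟩ ∧ P.1 ∈ rectSites x₀ i j Rr T then 1 else 0

/-- The projected rectangle `{(u,v) : u - x₀_i ∈ [0,Rr), v - x₀_j ∈ [0,T)}` of `𝕋²_L`.
[cite: ForsstromViklund2025currents, Cor. 6.4] -/
def prect (u₀ v₀ : ZMod L) (Rr T : ℕ) : Finset (ZMod L × ZMod L) :=
  Finset.univ.filter fun uv => (uv.1 - u₀).val < Rr ∧ (uv.2 - v₀).val < T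

/-- The fibre of `(u,v)` meets the rectangle in exactly the point `x₀[i ↦ u, j ↦ v]` if `(u,v)` lies
in the projected rectangle, and not at all otherwise. [folklore] -/
private theorem mem_fibre_and_mem_rectSites_iff {x₀ : Site d L} {i j : Fin d} (hij : i ≠ j)
    {Rr T : ℕ} {u v : ZMod L} {y : Site d L} :
    (y ∈ fibre i j u v ∧ y ∈ rectSites x₀ i j Rr T) ↔
      ((u, v) ∈ prect (x₀ i) (x₀ j) Rr T ∧ y = Function.update (Function.update x₀ i u) j v) := by
  simp only [mem_fibre, rectSites, prect, Finset.mem_filter, Finset.mem_univ, true_and]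
  constructor
  · rintro ⟨⟨hyi, hyj⟩, hR, hT, hrest⟩
    refine ⟨⟨by rw [← hyi]; exact hR, by rw [← hyj]; exact hT⟩, ?_⟩
    funext k
    by_cases hkj : k = j
    · subst hkj; simp [hyj]
    · by_cases hki : k = i
      · subst hki; simp [Function.update_of_ne hkj, hyi]
      · rw [Function.update_of_ne hkj, Function.update_of_ne hki]
        exact hrest k hki hkj
  · rintro ⟨⟨hR, hT⟩, rfl⟩
    refine ⟨⟨?_, ?_⟩, ?_, ?_, ?_⟩
    · simp [Function.update_of_ne hij]
    · simp
    · simpa [Function.update_of_ne hij] using hR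
    · simpa using hT
    · intro k hki hkj
      rw [Function.update_of_ne hkj, Function.update_of_ne hki]

/-- **The projected rectangle chain is the indicator of the projected rectangle.**
[cite: ForsstromViklund2025currents, Cor. 6.4] -/
theorem projChain_rectChain (x₀ : Site d L) {i j : Fin d} (hij : i < j) (Rr T : ℕ)
    (uv : ZMod L × ZMod L) :
    projChain i j hij (rectChain (R := R) x₀ hij Rr T) uv =
      if uv ∈ prect (x₀ i) (x₀ j) Rr T then 1 else 0 := by
  classical
  obtain ⟨u, v⟩ := uv
  simp only [projChain, rectChain, true_and]
  rw [Finset.sum_ite, Finset.sum_const_zero, add_zero, Finset.sum_const, nsmul_eq_mul, mul_one]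
  have hset : (fibre i j u v).filter (fun y => y ∈ rectSites x₀ i j Rr T) =
      if (u, v) ∈ prect (x₀ i) (x₀ j) Rr T then {Function.update (Function.update x₀ i u) j v}
      else ∅ := by
    ext y
    rw [Finset.mem_filter, mem_fibre_and_mem_rectSites_iff (ne_of_lt hij)]
    split_ifs with h
    · simp [h]
    · simp [h]
  rw [hset]
  split_ifs <;> simp

/-- `|{u ∈ ℤ_L : (u - u₀) mod L < Rr}| = Rr` for `Rr ≤ L`. [folklore] -/
private theorem card_filter_val_sub_lt (u₀ : ZMod L) {Rr : ℕ} (hR : Rr ≤ L) :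
    (Finset.univ.filter fun u : ZMod L => (u - u₀).val < Rr).card = Rr := by
  classical
  have himage : (Finset.univ.filter fun u : ZMod L => (u - u₀).val < Rr).image
      (fun u => (u - u₀).val) = Finset.range Rr := by
    ext n
    simp only [Finset.mem_image, Finset.mem_filter, Finset.mem_univ, true_and, Finset.mem_range]
    constructor
    · rintro ⟨u, hu, rfl⟩; exact hu
    · intro hn
      refine ⟨(n : ZMod L) + u₀, ?_, ?_⟩
      · simpa [ZMod.val_cast_of_lt (lt_of_lt_of_le hn hR)] using hn
      · simp [ZMod.val_cast_of_lt (lt_of_lt_of_le hn hR)]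
  have hinj : Set.InjOn (fun u : ZMod L => (u - u₀).val)
      ↑(Finset.univ.filter fun u : ZMod L => (u - u₀).val < Rr) := by
    intro u _ u' _ h
    have h' : u - u₀ = u' - u₀ := ZMod.val_injective L h
    simpa using h'
  rw [← Finset.card_image_of_injOn hinj, himage, Finset.card_range]

/-- `|prect| = Rr · T` for `Rr, T ≤ L`. [cite: ForsstromViklund2025currents, Cor. 6.4] -/
theorem card_prect (u₀ v₀ : ZMod L) {Rr T : ℕ} (hR : Rr ≤ L) (hT : T ≤ L) :
    (prect u₀ v₀ Rr T).card = Rr * T := by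
  classical
  have h : prect u₀ v₀ Rr T =
      (Finset.univ.filter fun u : ZMod L => (u - u₀).val < Rr) ×ˢ
        (Finset.univ.filter fun v : ZMod L => (v - v₀).val < T) := by
    ext ⟨u, v⟩
    simp [prect]
  rw [h, Finset.card_product, card_filter_val_sub_lt u₀ hR, card_filter_val_sub_lt v₀ hT]

/-- **The support of the rectangle chain has `Rr · T` plaquettes** (`Rr, T ≤ L`).
[cite: ForsstromViklund2025currents, Cor. 6.4] -/
theorem card_chainSupport_rectChain [DecidableEq R] [Nontrivial R] (x₀ : Site d L) {i j : Fin d}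
    (hij : i < j) {Rr T : ℕ} (hR : Rr ≤ L) (hT : T ≤ L) :
    (chainSupport (rectChain (R := R) x₀ hij Rr T)).card = Rr * T := by
  classical
  -- `supp ρ = {(y; i,j) : y ∈ rectSites}` ≃ rectSites ≃ prect
  have hsupp : chainSupport (rectChain (R := R) x₀ hij Rr T) =
      (rectSites x₀ i j Rr T).image fun y => (y, ⟨(i, j), hij⟩) := by
    ext P
    simp only [chainSupport, rectChain, Finset.mem_filter, Finset.mem_univ, true_and, ne_eq,
      ite_eq_right_iff, one_ne_zero, imp_false, not_not, Finset.mem_image]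
    constructor
    · rintro ⟨h2, h1⟩
      exact ⟨P.1, h1, by rw [← h2]⟩
    · rintro ⟨y, hy, rfl⟩
      exact ⟨rfl, hy⟩
  rw [hsupp, Finset.card_image_of_injective _ (fun y y' h => by simpa using h)]
  -- `rectSites ≃ prect` via `y ↦ (y_i, y_j)`
  have himage : (rectSites x₀ i j Rr T).image (fun y => (y i, y j)) = prect (x₀ i) (x₀ j) Rr T := by
    ext ⟨u, v⟩
    simp only [Finset.mem_image]
    constructor
    · rintro ⟨y, hy, hyuv⟩
      simp only [Prod.mk.injEq] at hyuv
      have h := (mem_fibre_and_mem_rectSites_iff (ne_of_lt hij)).mp ⟨mem_fibre.mpr hyuv, hy⟩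
      exact h.1
    · intro huv
      refine ⟨Function.update (Function.update x₀ i u) j v, ?_, ?_⟩
      · exact ((mem_fibre_and_mem_rectSites_iff (ne_of_lt hij)).mpr ⟨huv, rfl⟩).2
      · have h := ((mem_fibre_and_mem_rectSites_iff (ne_of_lt hij)).mpr ⟨huv, rfl⟩).1
        rw [mem_fibre] at h
        simp only [Prod.mk.injEq]
        exact h
  rw [← card_prect (x₀ i) (x₀ j) hR hT, ← himage, Finset.card_image_of_injOn]
  intro y hy y' hy' h
  simp only [Prod.mk.injEq] at h
  have h1 := ((mem_fibre_and_mem_rectSites_iff (ne_of_lt hij)).mp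
    ⟨mem_fibre.mpr ⟨rfl, rfl⟩, Finset.mem_coe.mp hy⟩).2
  have h2 := ((mem_fibre_and_mem_rectSites_iff (ne_of_lt hij)).mp
    ⟨mem_fibre.mpr ⟨h.1.symm, h.2.symm⟩, Finset.mem_coe.mp hy'⟩).2
  rw [h1, h2]

/-- **The isoperimetric count on the torus.** Every `R`-valued plaquette `2`-chain `τ` with the same
boundary as the `Rr × T` rectangle (`Rr, T ≤ L`, `R` a non-trivial ring) has at least
`min(Rr·T, L² - Rr·T)` plaquettes: its projection to `𝕋²_L` is `𝟙_{rectangle} + c` for a constant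
`c`, which is non-zero on the rectangle (`c ≠ -1`) or on its complement (`c = -1`).
[cite: ForsstromViklund2025currents, §6 Prop. 6.5 (area(γ_{R,T})); DuncanSchweinhart2025, §1 (minimal bounding chain)] -/
theorem min_le_card_chainSupport_of_bd₂_eq_rect [DecidableEq R] [Nontrivial R] (x₀ : Site d L)
    {i j : Fin d} (hij : i < j) {Rr T : ℕ} (hR : Rr ≤ L) (hT : T ≤ L) {τ : Plaquette d L → R}
    (hτ : bd₂ τ = bd₂ (rectChain (R := R) x₀ hij Rr T)) :
    min (Rr * T) (L * L - Rr * T) ≤ (chainSupport τ).card := by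
  classical
  refine le_trans ?_ (card_filter_projChain_ne_zero_le hij τ)
  set c : R := projChain i j hij τ (0, 0) - projChain i j hij (rectChain (R := R) x₀ hij Rr T) (0, 0)
    with hc
  have hproj : ∀ uv, projChain i j hij τ uv =
      (if uv ∈ prect (x₀ i) (x₀ j) Rr T then 1 else 0) + c := by
    intro uv
    rw [← projChain_rectChain x₀ hij Rr T uv, hc, ← projChain_sub_projChain_const hij hτ uv]
    ring
  have hcardT : (Finset.univ : Finset (ZMod L × ZMod L)).card = L * L := by
    rw [Finset.card_univ, Fintype.card_prod, ZMod.card]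
  have hRT : (prect (x₀ i) (x₀ j) Rr T).card = Rr * T := card_prect _ _ hR hT
  by_cases hc1 : c = -1
  · -- non-zero exactly off the rectangle
    have hset : (Finset.univ.filter fun uv : ZMod L × ZMod L => projChain i j hij τ uv ≠ 0) =
        (prect (x₀ i) (x₀ j) Rr T)ᶜ := by
      ext uv
      simp only [Finset.mem_filter, Finset.mem_univ, true_and, Finset.mem_compl, hproj uv, hc1]
      split_ifs with h <;> simp [h]
    rw [hset, Finset.card_compl, Fintype.card_prod, ZMod.card, hRT]
    exact min_le_right _ _
  · -- non-zero on the rectangle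
    refine (min_le_left _ _).trans ?_
    rw [← hRT]
    refine Finset.card_le_card fun uv huv => ?_
    simp only [Finset.mem_filter, Finset.mem_univ, true_and, hproj uv, if_pos huv]
    intro h
    exact hc1 (by linear_combination h)

end Rectangle

/-! ### The area of a rectangular loop -/

section AreaOfRectangle

variable {R : Type*} [CommRing R] [DecidableEq R] [Nontrivial R]

/-- `area(∂ρ) ≤ Rr·T`: the rectangle itself spans its boundary. [cite: ForsstromViklund2025currents, §6 Prop. 6.5 (area(γ_{R,T}))] -/
theorem area_bd₂_rectChain_le (x₀ : Site d L) {i j : Fin d} (hij : i < j) {Rr T : ℕ} (hR : Rr ≤ L)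
    (hT : T ≤ L) : area (bd₂ (rectChain (R := R) x₀ hij Rr T)) ≤ Rr * T := by
  rw [← card_chainSupport_rectChain (R := R) x₀ hij hR hT]
  exact area_le_card_chainSupport rfl

/-- **`area(∂ρ) ≥ min(Rr·T, L² - Rr·T)` on the torus.** [cite: ForsstromViklund2025currents, §6 Prop. 6.5 (area(γ_{R,T})); DuncanSchweinhart2025, §1 (minimal bounding chain)] -/
theorem min_le_area_bd₂_rectChain (x₀ : Site d L) {i j : Fin d} (hij : i < j) {Rr T : ℕ}
    (hR : Rr ≤ L) (hT : T ≤ L) :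
    min (Rr * T) (L * L - Rr * T) ≤ area (bd₂ (rectChain (R := R) x₀ hij Rr T)) := by
  have hmem : area (bd₂ (rectChain (R := R) x₀ hij Rr T)) ∈
      {n | ∃ τ : Plaquette d L → R,
        bd₂ τ = bd₂ (rectChain (R := R) x₀ hij Rr T) ∧ (chainSupport τ).card = n} :=
    Nat.sInf_mem ⟨_, _, rfl, rfl⟩
  obtain ⟨τ, hτ, hcard⟩ := hmem
  rw [← hcard]
  exact min_le_card_chainSupport_of_bd₂_eq_rect x₀ hij hR hT hτ

/-- **`area(∂(Rr × T)) = Rr·T` for `2·Rr·T ≤ L²`** — the evaluation used (without comment) in the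
printed passage from the Peierls estimate to the quark potential.
[cite: ForsstromViklund2025currents, §6 Prop. 6.5 (area(γ_{R,T}) and V_β(R) ≥ a_β R)] -/
theorem area_bd₂_rectChain_eq (x₀ : Site d L) {i j : Fin d} (hij : i < j) {Rr T : ℕ} (hR : Rr ≤ L)
    (hT : T ≤ L) (h2 : 2 * (Rr * T) ≤ L * L) :
    area (bd₂ (rectChain (R := R) x₀ hij Rr T)) = Rr * T := by
  refine le_antisymm (area_bd₂_rectChain_le x₀ hij hR hT) ?_
  have h := min_le_area_bd₂_rectChain (R := R) x₀ hij hR hT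
  have hmin : min (Rr * T) (L * L - Rr * T) = Rr * T := min_eq_left (by omega)
  rwa [hmin] at h

end AreaOfRectangle

/-! ### The two-sided area law for rectangular Wilson loops -/

section Wilson

variable (F : Type*) [Field F] [Fintype F] [DecidableEq F]

/-- **Area law for rectangles, plaquette random-cluster form**: `μ_{p,q}(V_{∂(Rr×T)}) ≤
(κp)^{Rr·T}/(1 - κp)` for `p ∈ (0,1)`, `q ≥ 1`, `κp < 1`, `2·Rr·T ≤ L²`.
[cite: DuncanSchweinhart2025, Thm. 7 (area-law side, hyperrectangular boundaries)] -/
theorem eventProb_nullHomologous_rect_le {p q : ℝ} (hp : p ∈ Set.Ioo (0 : ℝ) 1) (hq : 1 ≤ q)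
    (hκ : (peierlsConst F d : ℝ) * p < 1) (x₀ : Site d L) {i j : Fin d} (hij : i < j) {Rr T : ℕ}
    (hR : Rr ≤ L) (hT : T ≤ L) (h2 : 2 * (Rr * T) ≤ L * L) :
    eventProb F p q {ω | IsNullHomologousIn ω (bd₂ (rectChain (R := F) x₀ hij Rr T))} ≤
      ((peierlsConst F d : ℝ) * p) ^ (Rr * T) / (1 - (peierlsConst F d : ℝ) * p) := by
  have h := eventProb_nullHomologous_le_areaLaw F hp hq hκ (bd₂ (rectChain (R := F) x₀ hij Rr T))
  rwa [area_bd₂_rectChain_eq x₀ hij hR hT h2] at h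

variable (q : ℕ) [Fact q.Prime]

/-- **Area law for rectangular Wilson loops of `q`-state Potts lattice gauge theory on `𝕋^d_L`,
upper bound** (prime `q`, `β > 0`, `κβ < 1`, `κ = 2(d-1)(q-1)`, `Rr, T ≤ L`, `2·Rr·T ≤ L²`):
`𝔼_{ν_β} W_{∂(Rr × T)} ≤ (κβ)^{Rr·T}/(1 - κβ)`, uniformly in `L`.
[cite: ForsstromViklund2025currents, Prop. 6.5; DuncanSchweinhart2025, Thm. 7] -/
theorem pottsExpect_wilsonLoop_rect_le {β : ℝ} (hβ : 0 < β)
    (hκ : (peierlsConst (ZMod q) d : ℝ) * β < 1) (x₀ : Site d L) {i j : Fin d} (hij : i < j)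
    {Rr T : ℕ} (hR : Rr ≤ L) (hT : T ≤ L) (h2 : 2 * (Rr * T) ≤ L * L) :
    (pottsExpect (d := d) (L := L) (ZMod q) β
        (wilsonLoopVar q (bd₂ (rectChain (R := ZMod q) x₀ hij Rr T)))).re ≤
      ((peierlsConst (ZMod q) d : ℝ) * β) ^ (Rr * T) / (1 - (peierlsConst (ZMod q) d : ℝ) * β) := by
  have h := pottsExpect_wilsonLoopVar_re_le_areaLaw' q hβ hκ (bd₂ (rectChain (R := ZMod q) x₀ hij Rr T))
  rwa [area_bd₂_rectChain_eq x₀ hij hR hT h2] at h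

/-- **Area law for rectangular Wilson loops, lower bound** (prime `q`, `β > 0`, `Rr, T ≤ L`):
`𝔼_{ν_β} W_{∂(Rr × T)} ≥ ((e^β - 1)/(e^β - 1 + q))^{Rr·T}`, uniformly in `L`.
[cite: DuncanSchweinhart2025, Thm. 7 and §5.5 (exp(-c Area(γ)) ≤ μ(V_γ))] -/
theorem pow_le_pottsExpect_wilsonLoop_rect {β : ℝ} (hβ : 0 < β) (x₀ : Site d L) {i j : Fin d}
    (hij : i < j) {Rr T : ℕ} (hR : Rr ≤ L) (hT : T ≤ L) :
    ((Real.exp β - 1) / (Real.exp β - 1 + q)) ^ (Rr * T) ≤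
      (pottsExpect (d := d) (L := L) (ZMod q) β
        (wilsonLoopVar q (bd₂ (rectChain (R := ZMod q) x₀ hij Rr T)))).re := by
  have h := pow_le_pottsExpect_wilsonLoopVar_re q hβ (rectChain (R := ZMod q) x₀ hij Rr T)
  rwa [card_chainSupport_rectChain x₀ hij hR hT] at h

end Wilson

/-! ### Translation invariance and the supermultiplicativity of rectangular Wilson loops
(the finite-volume content of [ForsstromViklund2025currents, Cor. 6.4]) -/

section Translation

variable {G : Type*} [AddCommGroup G] [DecidableEq G]

/-- The number of flat plaquettes is invariant under torus translations `θ ↦ θ(· + v)`.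
[cite: DuncanSchweinhart2025, §1.1 Def. 2] -/
theorem flatCount_shiftCochain₁ (v : Site d L) (θ : Site d L → Fin d → G) :
    flatCount G (shiftCochain₁ v θ) = flatCount G θ := by
  unfold flatCount
  rw [td₁_shiftCochain₁]
  refine Finset.card_bij' (fun P _ => (P.1 + v, P.2)) (fun P _ => (P.1 - v, P.2)) ?_ ?_ ?_ ?_
  · intro P hP
    simpa [res, shiftCochain₂] using hP
  · intro P hP
    simpa [res, shiftCochain₂] using hP
  · intro P _; simp
  · intro P _; simp

variable [Fintype G]

/-- **Translation invariance of Potts lattice gauge theory on the torus**: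
`𝔼_β[F(θ(· + v))] = 𝔼_β[F]`. [cite: DuncanSchweinhart2025, §1.1 Def. 2] -/
theorem pottsExpect_comp_shiftCochain₁ (β : ℝ) (v : Site d L) (F : (Site d L → Fin d → G) → ℂ) :
    pottsExpect (d := d) (L := L) G β (fun θ => F (shiftCochain₁ v θ)) = pottsExpect G β F := by
  unfold pottsExpect pottsProb
  let e : (Site d L → Fin d → G) ≃ (Site d L → Fin d → G) :=
    { toFun := shiftCochain₁ v
      invFun := shiftCochain₁ (-v)
      left_inv := fun θ => by funext x k; simp [shiftCochain₁]
      right_inv := fun θ => by funext x k; simp [shiftCochain₁] }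
  calc ∑ θ : Site d L → Fin d → G,
        ((pottsWeight G β θ / pottsPartitionFn G β : ℝ) : ℂ) * F (shiftCochain₁ v θ)
      = ∑ θ : Site d L → Fin d → G,
        ((pottsWeight G β (e θ) / pottsPartitionFn G β : ℝ) : ℂ) * F (e θ) := by
          refine Finset.sum_congr rfl fun θ _ => ?_
          simp only [e, Equiv.coe_fn_mk, pottsWeight_eq, flatCount_shiftCochain₁]
    _ = ∑ θ : Site d L → Fin d → G, ((pottsWeight G β θ / pottsPartitionFn G β : ℝ) : ℂ) * F θ :=
          e.sum_comp (fun θ => ((pottsWeight G β θ / pottsPartitionFn G β : ℝ) : ℂ) * F θ)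

variable {R : Type*} [CommRing R]

/-- Pairing with a translated chain: `⟨θ, γ(· - v)⟩ = ⟨θ(· + v), γ⟩`. [cite: DuncanSchweinhart2025, §1.1 Def. 3 (f(γ))] -/
theorem pairing_shiftCochain₁_neg (θ γ : Site d L → Fin d → R) (v : Site d L) :
    pairing θ (shiftCochain₁ (-v) γ) = pairing (shiftCochain₁ v θ) γ := by
  unfold pairing shiftCochain₁
  simp only [← sub_eq_add_neg]
  exact Fintype.sum_equiv (Equiv.subRight v) _ _ fun x => by
    simp only [Equiv.subRight_apply, sub_add_cancel]

/-- **Translating a loop**: `W_{γ(· - v)}(θ) = W_γ(θ(· + v))`. [cite: DuncanSchweinhart2025, §1.1 Def. 3] -/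
theorem wilsonLoopVar_shiftCochain₁_neg (q : ℕ) [NeZero q] (γ θ : Site d L → Fin d → ZMod q)
    (v : Site d L) : wilsonLoopVar q (shiftCochain₁ (-v) γ) θ = wilsonLoopVar q γ (shiftCochain₁ v θ) := by
  unfold wilsonLoopVar
  rw [pairing_shiftCochain₁_neg]

/-- **Wilson loop expectations are translation invariant**: `𝔼_β W_{γ(· - v)} = 𝔼_β W_γ`.
[cite: ForsstromViklund2025currents, Cor. 6.4 (proof: translation invariance)] -/
theorem pottsExpect_wilsonLoopVar_shift (q : ℕ) [NeZero q] (β : ℝ) (γ : Site d L → Fin d → ZMod q)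
    (v : Site d L) :
    pottsExpect (d := d) (L := L) (ZMod q) β (wilsonLoopVar q (shiftCochain₁ (-v) γ)) =
      pottsExpect (ZMod q) β (wilsonLoopVar q γ) := by
  have h : wilsonLoopVar (d := d) (L := L) q (shiftCochain₁ (-v) γ) =
      fun θ => wilsonLoopVar q γ (shiftCochain₁ v θ) :=
    funext fun θ => wilsonLoopVar_shiftCochain₁_neg q γ θ v
  rw [h]
  exact pottsExpect_comp_shiftCochain₁ β v (wilsonLoopVar q γ)

/-- Translate a plaquette `2`-chain: `(shiftChain₂ v c)(y; π) = c(y + v; π)`. [cite: DuncanSchweinhart2025, §2.1 (chains)] -/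
def shiftChain₂ (v : Site d L) (c : Plaquette d L → R) : Plaquette d L → R := fun P => c (P.1 + v, P.2)

/-- **`∂` commutes with translations**: `∂(c(· + v)) = (∂c)(· + v)`. [cite: DuncanSchweinhart2025, §2.1 (∂)] -/
theorem bd₂_shiftChain₂ (v : Site d L) (c : Plaquette d L → R) :
    bd₂ (shiftChain₂ v c) = shiftCochain₁ v (bd₂ c) := by
  funext x k
  simp only [bd₂, shiftChain₂, shiftCochain₁]
  -- reindex the plaquette sum by `P ↦ (P.1 + v, P.2)`
  have hres : ∀ P : Plaquette d L, res (td₁ (edgeInd (R := R) x k)) P =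
      res (td₁ (edgeInd (R := R) (x + v) k)) (P.1 + v, P.2) := by
    intro P
    have hθ : edgeInd (R := R) x k = shiftCochain₁ v (edgeInd (R := R) (x + v) k) := by
      funext z l
      simp [edgeInd, shiftCochain₁]
    rw [hθ, td₁_shiftCochain₁]
    rfl
  simp_rw [hres]
  exact Fintype.sum_equiv ((Equiv.addRight v).prodCongr (Equiv.refl _)) _ _ fun P => rfl

/-- The translated rectangle is the rectangle with translated corner:
`rectChain (x₀ + v) = (rectChain x₀)(· - v)`. [cite: ForsstromViklund2025currents, Cor. 6.4] -/
theorem rectChain_add_corner (x₀ v : Site d L) {i j : Fin d} (hij : i < j) (Rr T : ℕ) :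
    rectChain (R := R) (x₀ + v) hij Rr T = shiftChain₂ (-v) (rectChain (R := R) x₀ hij Rr T) := by
  funext P
  simp only [rectChain, shiftChain₂, rectSites, Finset.mem_filter, Finset.mem_univ, true_and,
    Pi.add_apply, Pi.neg_apply]
  have h1 : ∀ k, P.1 k - (x₀ k + v k) = P.1 k + -v k - x₀ k := fun k => by ring
  have h2 : ∀ k, (P.1 k = x₀ k + v k) ↔ (P.1 k + -v k = x₀ k) := fun k => by
    constructor <;> intro h <;> linear_combination h
  simp only [h1, h2]

variable (q : ℕ) [Fact q.Prime]

/-- **Translation invariance of rectangular Wilson loops**: the expectation does not depend on the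
corner. [cite: ForsstromViklund2025currents, Cor. 6.4] -/
theorem pottsExpect_wilsonLoop_rect_corner (β : ℝ) (x₀ v : Site d L) {i j : Fin d} (hij : i < j)
    (Rr T : ℕ) :
    pottsExpect (d := d) (L := L) (ZMod q) β
        (wilsonLoopVar q (bd₂ (rectChain (R := ZMod q) (x₀ + v) hij Rr T))) =
      pottsExpect (ZMod q) β (wilsonLoopVar q (bd₂ (rectChain (R := ZMod q) x₀ hij Rr T))) := by
  rw [rectChain_add_corner, bd₂_shiftChain₂, pottsExpect_wilsonLoopVar_shift]

/-- **Supermultiplicativity in a spanning chain** (Griffiths II): `𝔼_β W_{∂(c+c')} ≥ 𝔼_β W_{∂c} · 𝔼_β W_{∂c'}`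
for all plaquette `2`-chains `c, c'` (`q` prime, `β > 0`).
[cite: ForsstromViklund2025currents, Cor. 6.4 (proof: Prop. 6.3(i) ⇒ subadditivity)] -/
theorem pottsExpect_wilsonLoopVar_bd₂_add_ge {β : ℝ} (hβ : 0 < β) (c c' : Plaquette d L → ZMod q) :
    (pottsExpect (d := d) (L := L) (ZMod q) β (wilsonLoopVar q (bd₂ c))).re *
        (pottsExpect (d := d) (L := L) (ZMod q) β (wilsonLoopVar q (bd₂ c'))).re ≤
      (pottsExpect (d := d) (L := L) (ZMod q) β (wilsonLoopVar q (bd₂ (c + c')))).re := by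
  have hadd : bd₂ (c + c') = bd₂ c + bd₂ c' := by
    funext x k
    simp only [bd₂, Pi.add_apply, add_mul, Finset.sum_add_distrib]
  have hfun : wilsonLoopVar (d := d) (L := L) q (bd₂ (c + c')) =
      fun θ => wilsonLoopVar q (bd₂ c) θ * wilsonLoopVar q (bd₂ c') θ := by
    funext θ; rw [wilsonLoopVar_mul, hadd]
  rw [hfun]
  exact pottsExpect_wilsonLoopVar_mul_ge q hβ (bd₂ c) (bd₂ c')

end Translation

/-! ### Concatenating rectangles: `ρ(Rr, T + T') = ρ(Rr, T) + ρ'(Rr, T')` and the supermultiplicativity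
in the side length ([ForsstromViklund2025currents, Cor. 6.4]) -/

section Concatenation

/-- If `(w - T) mod L < T'` with `T + T' ≤ L` then `w mod L ≥ T`. [folklore] -/
private theorem le_val_of_val_sub_lt {w : ZMod L} {T T' : ℕ} (h : T + T' ≤ L)
    (hlt : (w - (T : ZMod L)).val < T') : T ≤ w.val := by
  have hTL : T < L ∨ T = L := (Nat.lt_or_eq_of_le (le_trans (Nat.le_add_right T T') h))
  rcases hTL with hTL | hTL
  · have hTval : ((T : ℕ) : ZMod L).val = T := ZMod.val_cast_of_lt hTL
    have hsum : (w - (T : ZMod L)).val + ((T : ℕ) : ZMod L).val < L := by rw [hTval]; omega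
    have := ZMod.val_add_of_lt hsum
    rw [sub_add_cancel, hTval] at this
    omega
  · subst hTL; omega

/-- If `w mod L ≥ T` (`T + T' ≤ L`) then `(w - T) mod L = w mod L - T`. [folklore] -/
private theorem val_sub_natCast_of_le {w : ZMod L} {T : ℕ} (hle : T ≤ w.val) :
    (w - (T : ZMod L)).val = w.val - T := by
  have hTL : T < L := lt_of_le_of_lt hle (ZMod.val_lt w)
  have hTval : ((T : ℕ) : ZMod L).val = T := ZMod.val_cast_of_lt hTL
  rw [ZMod.val_sub (by rw [hTval]; exact hle), hTval]

/-- Splitting `[0, T + T')` at `T` in `ℤ_L` (`T + T' ≤ L`). [folklore] -/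
private theorem val_lt_add_iff {w : ZMod L} {T T' : ℕ} (h : T + T' ≤ L) :
    w.val < T + T' ↔ (w.val < T ∨ (w - (T : ZMod L)).val < T') := by
  constructor
  · intro hw
    by_cases hT : w.val < T
    · exact Or.inl hT
    · right
      rw [val_sub_natCast_of_le (not_lt.mp hT)]
      omega
  · rintro (hw | hw)
    · omega
    · have hle := le_val_of_val_sub_lt h hw
      rw [val_sub_natCast_of_le hle] at hw
      omega

/-- The two halves are disjoint. [folklore] -/
private theorem not_val_lt_and_val_sub_lt {w : ZMod L} {T T' : ℕ} (h : T + T' ≤ L) :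
    ¬(w.val < T ∧ (w - (T : ZMod L)).val < T') := fun hw =>
  absurd (le_val_of_val_sub_lt h hw.2) (not_le.mpr hw.1)

variable {R : Type*} [CommRing R]

/-- The sites of the `Rr × (T + T')` rectangle split into those of the `Rr × T` rectangle with the
same corner and those of the `Rr × T'` rectangle with corner moved by `T e_j` (`T + T' ≤ L`).
[cite: ForsstromViklund2025currents, Cor. 6.4 (proof: subadditivity in T)] -/
theorem rectSites_add (x₀ : Site d L) {i j : Fin d} (hij : i ≠ j) (Rr T T' : ℕ) (h : T + T' ≤ L) :
    rectSites x₀ i j Rr (T + T') =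
      rectSites x₀ i j Rr T ∪ rectSites (Function.update x₀ j (x₀ j + (T : ZMod L))) i j Rr T' := by
  ext y
  simp only [rectSites, Finset.mem_filter, Finset.mem_univ, true_and, Finset.mem_union,
    Function.update_self, Function.update_of_ne hij]
  have hrest : (∀ k, k ≠ i → k ≠ j → y k = Function.update x₀ j (x₀ j + (T : ZMod L)) k) ↔
      (∀ k, k ≠ i → k ≠ j → y k = x₀ k) := by
    refine forall_congr' fun k => forall_congr' fun _ => forall_congr' fun hkj => ?_
    rw [Function.update_of_ne hkj]
  rw [hrest, sub_add_eq_sub_sub, val_lt_add_iff h]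
  tauto

/-- The two halves of a split rectangle are disjoint. [cite: ForsstromViklund2025currents, Cor. 6.4] -/
theorem disjoint_rectSites (x₀ : Site d L) (i j : Fin d) (Rr T T' : ℕ) (h : T + T' ≤ L) :
    Disjoint (rectSites x₀ i j Rr T)
      (rectSites (Function.update x₀ j (x₀ j + (T : ZMod L))) i j Rr T') := by
  rw [Finset.disjoint_left]
  intro y hy hy'
  simp only [rectSites, Finset.mem_filter, Finset.mem_univ, true_and, Function.update_self,
    sub_add_eq_sub_sub] at hy hy'
  exact not_val_lt_and_val_sub_lt h ⟨hy.2.1, hy'.2.1⟩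

/-- **Concatenation of rectangles**: for `T + T' ≤ L`, the `Rr × (T + T')` rectangle chain with corner
`x₀` is the sum of the `Rr × T` one with corner `x₀` and the `Rr × T'` one with corner `x₀ + T e_j`.
[cite: ForsstromViklund2025currents, Cor. 6.4 (proof: subadditivity in T)] -/
theorem rectChain_add (x₀ : Site d L) {i j : Fin d} (hij : i < j) (Rr T T' : ℕ) (h : T + T' ≤ L) :
    rectChain (R := R) x₀ hij Rr (T + T') =
      rectChain (R := R) x₀ hij Rr T +
        rectChain (R := R) (Function.update x₀ j (x₀ j + (T : ZMod L))) hij Rr T' := by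
  have hne : i ≠ j := ne_of_lt hij
  funext P
  simp only [rectChain, Pi.add_apply, rectSites_add x₀ hne Rr T T' h, Finset.mem_union]
  have hdis : P.1 ∈ rectSites x₀ i j Rr T →
      P.1 ∉ rectSites (Function.update x₀ j (x₀ j + (T : ZMod L))) i j Rr T' :=
    fun h1 => Finset.disjoint_left.mp (disjoint_rectSites x₀ i j Rr T T' h) h1
  by_cases hpl : P.2 = ⟨(i, j), hij⟩
  · by_cases h1 : P.1 ∈ rectSites x₀ i j Rr T
    · have h2 := hdis h1
      simp [hpl, h1, h2]
    · by_cases h2 : P.1 ∈ rectSites (Function.update x₀ j (x₀ j + (T : ZMod L))) i j Rr T'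
      · simp [hpl, h1, h2]
      · simp [hpl, h1, h2]
  · simp [hpl]

variable (q : ℕ) [Fact q.Prime]

/-- **Supermultiplicativity of rectangular Wilson loops in the side length** (the finite-volume
content of the existence of the quark potential `V_β(R) = -lim_T T⁻¹ log⟨W_{γ_{R,T}}⟩`): for prime
`q`, `β > 0`, `T + T' ≤ L`,
`𝔼_β W_{∂ρ(Rr, T+T')} ≥ 𝔼_β W_{∂ρ(Rr, T)} · 𝔼_β W_{∂ρ(Rr, T')}` — by Griffiths II and translation
invariance. (The Fekete limit `T → ∞` needs the infinite volume and is not typed.)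
[cite: ForsstromViklund2025currents, Cor. 6.4] -/
theorem pottsExpect_wilsonLoop_rect_supermul {β : ℝ} (hβ : 0 < β) (x₀ : Site d L) {i j : Fin d}
    (hij : i < j) (Rr T T' : ℕ) (h : T + T' ≤ L) :
    (pottsExpect (d := d) (L := L) (ZMod q) β
          (wilsonLoopVar q (bd₂ (rectChain (R := ZMod q) x₀ hij Rr T)))).re *
        (pottsExpect (d := d) (L := L) (ZMod q) β
          (wilsonLoopVar q (bd₂ (rectChain (R := ZMod q) x₀ hij Rr T')))).re ≤
      (pottsExpect (d := d) (L := L) (ZMod q) β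
          (wilsonLoopVar q (bd₂ (rectChain (R := ZMod q) x₀ hij Rr (T + T'))))).re := by
  set x₁ : Site d L := Function.update x₀ j (x₀ j + (T : ZMod L)) with hx₁
  have hcorner : pottsExpect (d := d) (L := L) (ZMod q) β
        (wilsonLoopVar q (bd₂ (rectChain (R := ZMod q) x₁ hij Rr T'))) =
      pottsExpect (ZMod q) β (wilsonLoopVar q (bd₂ (rectChain (R := ZMod q) x₀ hij Rr T'))) := by
    have h' := pottsExpect_wilsonLoop_rect_corner q β x₀ (x₁ - x₀) hij Rr T'
    rwa [add_sub_cancel] at h'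
  rw [rectChain_add x₀ hij Rr T T' h, ← hx₁, ← hcorner]
  exact pottsExpect_wilsonLoopVar_bd₂_add_ge q hβ _ _

end Concatenation

/-! ### The `q = 2` dictionary with [ForsstromViklund2025currents] -/

section IsingDictionary

/-- `p̂(1 - e^{-β}, 2) = (e^β - 1)/(e^β + 1) = tanh(β/2)`: in the normalisation `β = 4β_FV` of
[ForsstromViklund2025currents] (weight `exp(β_FV Σ_{p ∈ C₂} σ_p)` over both orientations), the two
Bernoulli parameters of the sandwich `ψ_{p̂} ≤ μ ≤ ψ_p` are `tanh 2β_FV` and `1 - e^{-4β_FV}` — those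
of Prop. 6.6 / Thm. 1.3 (`X₂ ∼ Ψ_{tanh 2β}`) and eq. (1.7) there.
[cite: ForsstromViklund2025currents, Prop. 6.6 and eq. (1.7)] -/
theorem hatParam_esParam_two (β : ℝ) : hatParam (esParam β) 2 = Real.tanh (β / 2) := by
  rw [hatParam_esParam, Real.tanh_eq]
  set e : ℝ := Real.exp (β / 2) with he
  have hβ : β = β / 2 + β / 2 := by ring
  have hexp : Real.exp β = e * e := by rw [he, ← Real.exp_add, ← hβ]
  have hneg : Real.exp (-(β / 2)) = e⁻¹ := Real.exp_neg _
  have hpos : 0 < e := Real.exp_pos _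
  have hne : e ≠ 0 := hpos.ne'
  have hden1 : e * e - 1 + (2 : ℝ) ≠ 0 := by nlinarith
  have hden2 : e + e⁻¹ ≠ 0 := (add_pos hpos (inv_pos.mpr hpos)).ne'
  rw [hexp, hneg, div_eq_div_iff hden1 hden2]
  field_simp
  ring

/-- **[ForsstromViklund2025currents, (1.7) + Prop. 6.6] for Wilson loops, on the torus**: for Ising
(`q = 2`) lattice gauge theory with weight `e^{β #flat}` (`β = 4β_FV`), `β > 0`, and every `ℤ₂`
`1`-chain `γ`: `ψ_{tanh(β/2)}(V_γ) ≤ 𝔼_β W_γ ≤ ψ_{1-e^{-β}}(V_γ)`.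
[cite: ForsstromViklund2025currents, eq. (1.7) and Prop. 6.6] -/
theorem wilsonLoop_percolation_sandwich_two {β : ℝ} (hβ : 0 < β) (γ : Site d L → Fin d → ZMod 2) :
    eventProb (d := d) (L := L) (ZMod 2) (Real.tanh (β / 2)) 1 {ω | IsNullHomologousIn ω γ} ≤
        (pottsExpect (d := d) (L := L) (ZMod 2) β (wilsonLoopVar 2 γ)).re ∧
      (pottsExpect (d := d) (L := L) (ZMod 2) β (wilsonLoopVar 2 γ)).re ≤
        eventProb (d := d) (L := L) (ZMod 2) (esParam β) 1 {ω | IsNullHomologousIn ω γ} := by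
  have h := wilsonLoop_percolation_sandwich 2 hβ γ
  rw [Nat.cast_ofNat, hatParam_esParam_two] at h
  exact h

end IsingDictionary

end PlaquetteRC

end Literature.MathematicalPhysics.QuantumFieldTheory
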